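import Literature.Probability.Process.NewtonPotential
import HarnessLib

/-!
# The logarithmic potential of the plane is harmonic; the Laplacian of the squared distance

Topic `Probability/Process` (support for exit estimates of planar Brownian motion through Dynkin's
formula, `BrownianVec` / `BrownianVecHarmonic`, whose Laplacian is `lap` of `GaussianTaylorStep`:
the trace of `fderiv (fderiv ·)` on `ℝᵈ = Fin d → ℝ`). On `ℝ² = Fin 2 → ℝ`, for a centre `(a, b)`:

* `lap_logDist_eq_zero` — **`Δ ½ log((x − a)² + (y − b)²) = 0`** off the centre (Le Gall (2016),
  Ch. 7, Lemma 7.12: the radial harmonic functions in the plane are `c₁ + c₂ log |x|`), and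
  `contDiffOn_logDist` (it is `C²` there);
* `lap_sqDist` — **`Δ ((x − a)² + (y − b)²) = 4`**, and `contDiff_sqDist`.

The second derivatives along the coordinate lines are computed with `hess_apply_eq_of_line`
(`NewtonPotential`) from the one-variable functions `s ↦ ½ log(c + 2βs + s²)` and
`s ↦ c + 2βs + s²`. Everything is proved; no definition is introduced (the two potentials are
written as explicit lambdas).

## References

* J.-F. Le Gall, *Brownian Motion, Martingales, and Stochastic Calculus*, GTM 274 (2016), Ch. 7,
  Lemma 7.12. [Legall2016]
-/

noncomputable section

open Filter Topology Set
open scoped BigOperators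

namespace Literature.Probability.Process

/-! ### One-variable calculus -/

/-- Derivative of `s ↦ ½ log(c + 2βs + s²)` where the quadratic is positive:
`(β + s)/(c + 2βs + s²)`. [folklore] -/
theorem hasDerivAt_half_log_quad {c β s : ℝ} (hq : 0 < c + 2 * β * s + s ^ 2) :
    HasDerivAt (fun s : ℝ ↦ Real.log (c + 2 * β * s + s ^ 2) / 2)
      ((β + s) / (c + 2 * β * s + s ^ 2)) s := by
  have h := ((hasDerivAt_quad c β s).log hq.ne').div_const 2
  refine h.congr_deriv ?_
  rw [div_div, div_eq_div_iff (by positivity) hq.ne']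
  ring

/-- Derivative at `0` of `s ↦ (β + s)/(c + 2βs + s²)`: `(c − 2β²)/c²` (`c ≠ 0`). [folklore] -/
theorem hasDerivAt_lineDeriv_log_zero {c β : ℝ} (hc : c ≠ 0) :
    HasDerivAt (fun s : ℝ ↦ (β + s) / (c + 2 * β * s + s ^ 2)) ((c - 2 * β ^ 2) / c ^ 2) 0 := by
  have hnum : HasDerivAt (fun s : ℝ ↦ β + s) 1 0 := (hasDerivAt_id (0 : ℝ)).const_add β
  have hden := hasDerivAt_quad c β 0
  have hden0 : c + 2 * β * 0 + 0 ^ 2 ≠ 0 := by simpa using hc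
  have h := hnum.div hden hden0
  refine h.congr_deriv ?_
  field_simp
  ring

/-- Second derivative of the quadratic: the derivative of `s ↦ 2β + 2s` is `2`. [folklore] -/
theorem hasDerivAt_lineDeriv_quad (β s : ℝ) : HasDerivAt (fun s : ℝ ↦ 2 * β + 2 * s) 2 s := by
  have h := ((hasDerivAt_id s).const_mul 2).const_add (2 * β)
  refine h.congr_deriv ?_
  simp

/-! ### Coordinates along the coordinate lines of `ℝ²` -/

/-- Moving along `e₀` changes the first coordinate. [folklore] -/
@[simp] theorem add_smul_bvec_zero_apply_zero (y : Fin 2 → ℝ) (s : ℝ) :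
    (y + s • bvec (0 : Fin 2) : Fin 2 → ℝ) 0 = y 0 + s := by
  simp [bvec]

/-- Moving along `e₀` does not change the second coordinate. [folklore] -/
@[simp] theorem add_smul_bvec_zero_apply_one (y : Fin 2 → ℝ) (s : ℝ) :
    (y + s • bvec (0 : Fin 2) : Fin 2 → ℝ) 1 = y 1 := by
  simp [bvec]

/-- Moving along `e₁` does not change the first coordinate. [folklore] -/
@[simp] theorem add_smul_bvec_one_apply_zero (y : Fin 2 → ℝ) (s : ℝ) :
    (y + s • bvec (1 : Fin 2) : Fin 2 → ℝ) 0 = y 0 := by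
  simp [bvec]

/-- Moving along `e₁` changes the second coordinate. [folklore] -/
@[simp] theorem add_smul_bvec_one_apply_one (y : Fin 2 → ℝ) (s : ℝ) :
    (y + s • bvec (1 : Fin 2) : Fin 2 → ℝ) 1 = y 1 + s := by
  simp [bvec]

/-! ### The squared distance `(x − a)² + (y − b)²` -/

/-- The squared distance to `(a, b)` is smooth. [folklore] -/
theorem contDiff_sqDist (a b : ℝ) {n : WithTop ℕ∞} :
    ContDiff ℝ n fun v : Fin 2 → ℝ ↦ (v 0 - a) ^ 2 + (v 1 - b) ^ 2 :=
  (((contDiff_apply ℝ ℝ (0 : Fin 2)).sub contDiff_const).pow 2).add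
    (((contDiff_apply ℝ ℝ (1 : Fin 2)).sub contDiff_const).pow 2)

/-- The squared distance is continuous. [folklore] -/
theorem continuous_sqDist (a b : ℝ) : Continuous fun v : Fin 2 → ℝ ↦ (v 0 - a) ^ 2 + (v 1 - b) ^ 2 :=
  (contDiff_sqDist a b).continuous (n := 0)

/-- The diagonal Hessian entries of the squared distance are `2`. [folklore] -/
theorem hess_sqDist (a b : ℝ) (y : Fin 2 → ℝ) (i : Fin 2) :
    hess (fun v : Fin 2 → ℝ ↦ (v 0 - a) ^ 2 + (v 1 - b) ^ 2) y (bvec i) (bvec i) = 2 := by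
  fin_cases i
  · refine hess_apply_eq_of_line isOpen_univ (contDiff_sqDist a b).contDiffOn (mem_univ y) (bvec 0)
      (D₁ := fun s ↦ 2 * (y 0 - a) + 2 * s) (Eventually.of_forall fun s ↦ ?_)
      (hasDerivAt_lineDeriv_quad (y 0 - a) 0)
    have heq : (fun s : ℝ ↦ ((y + s • bvec (0 : Fin 2)) 0 - a) ^ 2 + ((y + s • bvec (0 : Fin 2)) 1 - b) ^ 2) =
        fun s ↦ ((y 0 - a) ^ 2 + (y 1 - b) ^ 2) + 2 * (y 0 - a) * s + s ^ 2 := by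
      funext s
      rw [add_smul_bvec_zero_apply_zero, add_smul_bvec_zero_apply_one]
      ring
    rw [heq]
    exact hasDerivAt_quad _ _ s
  · refine hess_apply_eq_of_line isOpen_univ (contDiff_sqDist a b).contDiffOn (mem_univ y) (bvec 1)
      (D₁ := fun s ↦ 2 * (y 1 - b) + 2 * s) (Eventually.of_forall fun s ↦ ?_)
      (hasDerivAt_lineDeriv_quad (y 1 - b) 0)
    have heq : (fun s : ℝ ↦ ((y + s • bvec (1 : Fin 2)) 0 - a) ^ 2 + ((y + s • bvec (1 : Fin 2)) 1 - b) ^ 2) =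
        fun s ↦ ((y 0 - a) ^ 2 + (y 1 - b) ^ 2) + 2 * (y 1 - b) * s + s ^ 2 := by
      funext s
      rw [add_smul_bvec_one_apply_zero, add_smul_bvec_one_apply_one]
      ring
    rw [heq]
    exact hasDerivAt_quad _ _ s

/-- **`Δ ((x − a)² + (y − b)²) = 4`.** [folklore] -/
theorem lap_sqDist (a b : ℝ) (y : Fin 2 → ℝ) :
    lap (fun v : Fin 2 → ℝ ↦ (v 0 - a) ^ 2 + (v 1 - b) ^ 2) y = 4 := by
  rw [lap, Fin.sum_univ_two, hess_sqDist, hess_sqDist]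
  norm_num

/-! ### The logarithmic potential `½ log((x − a)² + (y − b)²)` -/

/-- **The logarithmic potential is `C²` off the centre.** [folklore] -/
theorem contDiffOn_logDist (a b : ℝ) :
    ContDiffOn ℝ 2 (fun v : Fin 2 → ℝ ↦ Real.log ((v 0 - a) ^ 2 + (v 1 - b) ^ 2) / 2)
      {v | (v 0 - a) ^ 2 + (v 1 - b) ^ 2 ≠ 0} := fun _ hv ↦
  (((contDiff_sqDist a b).contDiffAt.log hv).div_const 2).contDiffWithinAt

/-- The off-centre region is open. [folklore] -/
theorem isOpen_sqDist_ne_zero (a b : ℝ) : IsOpen {v : Fin 2 → ℝ | (v 0 - a) ^ 2 + (v 1 - b) ^ 2 ≠ 0} :=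
  isOpen_ne_fun (continuous_sqDist a b) continuous_const

/-- The diagonal Hessian entry of the logarithmic potential along `e₀`:
`(c − 2β²)/c²` with `β = x − a`, `c = (x − a)² + (y − b)²`. [folklore] -/
theorem hess_logDist_zero (a b : ℝ) {y : Fin 2 → ℝ} (hy : (y 0 - a) ^ 2 + (y 1 - b) ^ 2 ≠ 0) :
    hess (fun v : Fin 2 → ℝ ↦ Real.log ((v 0 - a) ^ 2 + (v 1 - b) ^ 2) / 2) y (bvec 0) (bvec 0) =
      (((y 0 - a) ^ 2 + (y 1 - b) ^ 2) - 2 * (y 0 - a) ^ 2) / ((y 0 - a) ^ 2 + (y 1 - b) ^ 2) ^ 2 := by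
  set c : ℝ := (y 0 - a) ^ 2 + (y 1 - b) ^ 2 with hcdef
  have hc : 0 < c := lt_of_le_of_ne (by positivity) (Ne.symm hy)
  refine hess_apply_eq_of_line (isOpen_sqDist_ne_zero a b) (contDiffOn_logDist a b) hy (bvec 0)
    (D₁ := fun s ↦ ((y 0 - a) + s) / (c + 2 * (y 0 - a) * s + s ^ 2)) ?_
    (hasDerivAt_lineDeriv_log_zero hc.ne')
  -- near `0` the quadratic stays positive
  have hcont : Continuous fun s : ℝ ↦ c + 2 * (y 0 - a) * s + s ^ 2 := by fun_prop
  have hev : ∀ᶠ s in 𝓝 (0 : ℝ), 0 < c + 2 * (y 0 - a) * s + s ^ 2 :=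
    hcont.continuousAt.eventually
      (isOpen_Ioi.mem_nhds (by simpa using hc) : Ioi (0 : ℝ) ∈ 𝓝 (c + 2 * (y 0 - a) * 0 + 0 ^ 2))
  filter_upwards [hev] with s hs
  have heq : (fun s : ℝ ↦ Real.log (((y + s • bvec (0 : Fin 2)) 0 - a) ^ 2 +
      ((y + s • bvec (0 : Fin 2)) 1 - b) ^ 2) / 2) =
        fun s ↦ Real.log (c + 2 * (y 0 - a) * s + s ^ 2) / 2 := by
    funext s
    rw [add_smul_bvec_zero_apply_zero, add_smul_bvec_zero_apply_one]
    congr 2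
    rw [hcdef]; ring
  rw [heq]
  exact hasDerivAt_half_log_quad hs

/-- The diagonal Hessian entry of the logarithmic potential along `e₁`:
`(c − 2γ²)/c²` with `γ = y − b`. [folklore] -/
theorem hess_logDist_one (a b : ℝ) {y : Fin 2 → ℝ} (hy : (y 0 - a) ^ 2 + (y 1 - b) ^ 2 ≠ 0) :
    hess (fun v : Fin 2 → ℝ ↦ Real.log ((v 0 - a) ^ 2 + (v 1 - b) ^ 2) / 2) y (bvec 1) (bvec 1) =
      (((y 0 - a) ^ 2 + (y 1 - b) ^ 2) - 2 * (y 1 - b) ^ 2) / ((y 0 - a) ^ 2 + (y 1 - b) ^ 2) ^ 2 := by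
  set c : ℝ := (y 0 - a) ^ 2 + (y 1 - b) ^ 2 with hcdef
  have hc : 0 < c := lt_of_le_of_ne (by positivity) (Ne.symm hy)
  refine hess_apply_eq_of_line (isOpen_sqDist_ne_zero a b) (contDiffOn_logDist a b) hy (bvec 1)
    (D₁ := fun s ↦ ((y 1 - b) + s) / (c + 2 * (y 1 - b) * s + s ^ 2)) ?_
    (hasDerivAt_lineDeriv_log_zero hc.ne')
  have hcont : Continuous fun s : ℝ ↦ c + 2 * (y 1 - b) * s + s ^ 2 := by fun_prop
  have hev : ∀ᶠ s in 𝓝 (0 : ℝ), 0 < c + 2 * (y 1 - b) * s + s ^ 2 :=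
    hcont.continuousAt.eventually
      (isOpen_Ioi.mem_nhds (by simpa using hc) : Ioi (0 : ℝ) ∈ 𝓝 (c + 2 * (y 1 - b) * 0 + 0 ^ 2))
  filter_upwards [hev] with s hs
  have heq : (fun s : ℝ ↦ Real.log (((y + s • bvec (1 : Fin 2)) 0 - a) ^ 2 +
      ((y + s • bvec (1 : Fin 2)) 1 - b) ^ 2) / 2) =
        fun s ↦ Real.log (c + 2 * (y 1 - b) * s + s ^ 2) / 2 := by
    funext s
    rw [add_smul_bvec_one_apply_zero, add_smul_bvec_one_apply_one]
    congr 2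
    rw [hcdef]; ring
  rw [heq]
  exact hasDerivAt_half_log_quad hs

/-- **The logarithmic potential of the plane is harmonic off its pole**:
`Δ ½ log((x − a)² + (y − b)²) = 0`. [cite: Legall2016, Ch. 7 Lemma 7.12] -/
theorem lap_logDist_eq_zero (a b : ℝ) {y : Fin 2 → ℝ} (hy : (y 0 - a) ^ 2 + (y 1 - b) ^ 2 ≠ 0) :
    lap (fun v : Fin 2 → ℝ ↦ Real.log ((v 0 - a) ^ 2 + (v 1 - b) ^ 2) / 2) y = 0 := by
  rw [lap, Fin.sum_univ_two, hess_logDist_zero a b hy, hess_logDist_one a b hy, ← add_div]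
  have : (y 0 - a) ^ 2 + (y 1 - b) ^ 2 - 2 * (y 0 - a) ^ 2 + ((y 0 - a) ^ 2 + (y 1 - b) ^ 2 - 2 * (y 1 - b) ^ 2) = 0 := by
    ring
  rw [this, zero_div]

end Literature.Probability.Process

end
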